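import Summits.ResolutionOfSingularities.ResolutionOfSingularities.Theorems.FrobeniusLadderFInjectiveMacaulayficationDominatingLocFixRegularSupported
import Summits.ResolutionOfSingularities.ResolutionOfSingularities.Theorems.FrobeniusLadderFInjectiveMacaulayficationDominatingLocFixLocal
import HarnessLib

/-!
# The product-compatible regular local fix at local dimension three WITH SUPPORT CONTROL: `V(c) ⊆ Sing ∪ NonPrinc(J₀)` in `Spec 𝒪_ζ`
# (crux `FInjectiveMacaulayfication` stmt-ResolutionOfSingularities-15315, chain w45a; R16.43 (b2) sharpened as asked by res-L1-w45a-tri-2 21:58:16Z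
# (iv) / res-L1-w45a-plan-1 R16.45 (2) «the natural Z = closure(NonReg X₁ ∪ NonInv J₀)»; seat res-L1-w45a-stub-1 g6)

[OURS · L1 W4.5a] Support file (`--supports stmt-ResolutionOfSingularities-15315 --as helper`); NOT a statement of any manuscript; def-free; a
THEOREM modulo `CossartPiltant2019General` + `Stacks081R` + `CossartPiltant2019Principalization` BY NAME; AI-written (AI review is weaker than
expert review).

`exists_productCompatible_locFix_dimThree_supported (hG h081R hP)`: as `DominatingLocFixLocal.exists_productCompatible_locFix_dimThree` — germs `c`
with `(c) ≠ ⊥` and generators `d` of `J₀,ζ · (c)` whose affine blow-up charts are REGULAR and FULL at every prime — PLUS the support clause in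
the local ring: every prime `P ⊇ (c)` of `𝒪_{X₁,ζ}` has `(𝒪_ζ)_P` NON-regular or `J₀,ζ · (𝒪_ζ)_P` NON-principal. I.e. `V(c) ⊆ Sing(Spec 𝒪_ζ) ∪
NonPrinc(J₀,ζ)`: the factor `(c)` only touches generizations of `ζ` that are singular or where `J₀` is not yet invertible — the input `hN` of
res-L1-w45a-stub-2's support-controlled spread (`exists_spread_support_subset`) for `Z ⊇ Sing X₁ ∪ NonPrinc J₀`. Proof: the supported scheme-level
theorem `DominatingLocFixRegularSupported.exists_isBlowup_mul_isRegular_of_dim_three_supported'` on `S = Spec 𝒪_ζ` with `J = (J₀,ζ)~`; `𝔟 = 𝔮~`,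
`supp 𝔮~ = V(𝔮)` (`coe_support_ofIdealTop`, `Spec_zeroLocus`); the local ring of `S` at `P` is `(𝒪_ζ)_P` (`Spec.stalkIso`) and the stalk of
`(J₀,ζ)~` there is `J₀,ζ (𝒪_ζ)_P` (`stalkIdeal_eq_map_germ`, `Spec.germ_stalkMapIso_hom`).
[cite: CossartPiltant2019, Thm. 1.1 (i)(ii); Prop. 4.4] [cite: StacksProject, Tag 0804; Tag 080B] [cite: CossartPiltant2008, Prop. 4.2 (i)]
-/

-- single-problem summit: the doubled namespace component is forced
set_option linter.dupNamespace false

noncomputable section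

namespace Summit.ResolutionOfSingularities.ResolutionOfSingularities.Theorems.FInjectiveMacaulayfication.DominatingLocFixLocalSupported

open CategoryTheory CategoryTheory.Limits AlgebraicGeometry TopologicalSpace IsLocalRing
open Literature.AlgebraicGeometry.Resolution
open Summit.ResolutionOfSingularities.ResolutionOfSingularities.Theorems.FInjectiveMacaulayfication
open SliceableCentre FCUnguardedAprime

/-- Principal ideals extend to principal ideals. [folklore] -/
theorem isPrincipal_map {A B : Type} [CommRing A] [CommRing B] (f : A →+* B) {I : Ideal A} (h : I.IsPrincipal) :
    (I.map f).IsPrincipal := by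
  obtain ⟨a, ha⟩ := (Submodule.isPrincipal_iff _).mp h
  refine (Submodule.isPrincipal_iff _).mpr ⟨f a, ?_⟩
  rw [ha]
  change Ideal.map f (Ideal.span {a}) = Ideal.span {f a}
  rw [Ideal.map_span, Set.image_singleton]

/-- **The stalk of `I~` on `Spec R` at `P`, read in `R_P`**: the image of `stalkIdeal (I~) P` under `𝒪_{Spec R,P} ≅ R_P` is `I R_P`.
[folklore; cite: Hartshorne1977, Ch. II Prop. 5.1 (b)] -/
theorem map_stalkIso_stalkIdeal_idealSheaf {R : Type} [CommRing R] (I : Ideal R) (P : Spec (.of R)) :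
    (stalkIdeal (affineBlowup.idealSheaf I) P).map (Spec.stalkIso (.of R) P).hom.hom =
      I.map (algebraMap R (Localization.AtPrime P.asIdeal)) := by
  rw [stalkIdeal_eq_map_germ (affineBlowup.idealSheaf I) ⟨⊤, isAffineOpen_top _⟩ trivial, affineBlowup.idealSheaf,
    ideal_ofIdealTop_top, Ideal.map_map, Ideal.map_map]
  have h := Spec.germ_stalkMapIso_hom (R := CommRingCat.of R) P
  have h2 := congrArg (fun φ => (Scheme.ΓSpecIso (CommRingCat.of R)).inv ≫ φ) h
  simp only [Iso.inv_hom_id_assoc] at h2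
  have h3 := congrArg (fun φ => CommRingCat.Hom.hom φ) h2
  simp only [CommRingCat.hom_comp, CommRingCat.hom_ofHom] at h3
  rw [RingHom.comp_assoc] at h3
  change Ideal.map (((Spec.stalkIso (CommRingCat.of R) P).hom.hom.comp
      ((Spec (CommRingCat.of R)).presheaf.germ ⊤ P trivial).hom).comp (Scheme.ΓSpecIso (CommRingCat.of R)).inv.hom) I = _
  rw [RingHom.comp_assoc, h3]

set_option maxHeartbeats 400000 in
-- the support bookkeeping on `Spec 𝒪_ζ` elaborates large terms
/-- **(b2) with support control.** `DominatingLocFixLocal.exists_productCompatible_locFix_dimThree` plus: every prime `P ⊇ (c)` of `𝒪_{X₁,ζ}`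
has `(𝒪_ζ)_P` non-regular or `J₀,ζ (𝒪_ζ)_P` non-principal (`V(c) ⊆ Sing ∪ NonPrinc(J₀)` in `Spec 𝒪_ζ`). [OURS · conditional-result]
[cite: CossartPiltant2019, Thm. 1.1 (i)(ii); Prop. 4.4] [cite: StacksProject, Tag 0804] -/
theorem exists_productCompatible_locFix_dimThree_supported
    (hG : CossartPiltant2019General.{0}) (h081R : Stacks081R.{0}) (hP : CossartPiltant2019Principalization.{0})
    (p : ℕ) [hp : Fact p.Prime] {k : Type} [Field k] [CharP k p] {X₁ : Scheme.{0}} (f₁ : X₁ ⟶ Spec (.of k))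
    [LocallyOfFiniteType f₁] [IsIntegral X₁]
    (ζ : X₁) (hdim : ringKrullDim (X₁.presheaf.stalk ζ) = 3) (J₀ : X₁.IdealSheafData) (hJ₀ : J₀ ≠ ⊥) :
    ∃ (m : ℕ) (c : Fin m → X₁.presheaf.stalk ζ) (n : ℕ) (d : Fin n → X₁.presheaf.stalk ζ),
      Ideal.span (Set.range c) ≠ ⊥ ∧ Ideal.span (Set.range d) = stalkIdeal J₀ ζ * Ideal.span (Set.range c) ∧
      (∀ (j : Fin n) (𝔔 : PrimeSpectrum (blowupAlgebra (Ideal.span (Set.range d)) (d j))),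
        IsRegularLocalRing (Localization.AtPrime 𝔔.asIdeal) ∧ FullCl p (Localization.AtPrime 𝔔.asIdeal)) ∧
      ∀ P : PrimeSpectrum (X₁.presheaf.stalk ζ), Ideal.span (Set.range c) ≤ P.asIdeal →
        ¬ IsRegularLocalRing (Localization.AtPrime P.asIdeal) ∨
        ¬ ((stalkIdeal J₀ ζ).map (algebraMap (X₁.presheaf.stalk ζ) (Localization.AtPrime P.asIdeal))).IsPrincipal := by
  classical
  haveI : IsLocallyNoetherian X₁ := LocallyOfFiniteType.isLocallyNoetherian f₁
  -- `S := Spec 𝒪_{X₁,ζ}`: integral, Noetherian, affine, quasi-excellent, of dimension `3`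
  have hqX : Scheme.IsQuasiExcellent X₁ := Scheme.isQuasiExcellent_of_locallyOfFiniteType Stacks07QW_field_holds f₁
  have hqR : IsQuasiExcellentRing (X₁.presheaf.stalk ζ) := hqX.isQuasiExcellentRing_stalk ζ
  have hqe : Scheme.IsQuasiExcellent (Spec (.of (X₁.presheaf.stalk ζ))) :=
    Scheme.isQuasiExcellent_of_locallyOfFiniteType_of_isQuasiExcellentRing Stacks07QU_holds hqR (𝟙 _)
  have hdimS : topologicalKrullDim (Spec (.of (X₁.presheaf.stalk ζ))) = 3 := by
    change topologicalKrullDim (PrimeSpectrum (X₁.presheaf.stalk ζ)) = 3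
    rw [PrimeSpectrum.topologicalKrullDim_eq_ringKrullDim, hdim]
  have hI₀ : stalkIdeal J₀ ζ ≠ ⊥ := stalkIdeal_ne_bot_of_ne_bot hJ₀ ζ
  -- the SUPPORTED scheme-level product-compatible resolution applied to `(J₀,ζ)~`
  obtain ⟨𝔟, h𝔟, hsupp, -, hall⟩ :=
    DominatingLocFixRegularSupported.exists_isBlowup_mul_isRegular_of_dim_three_supported' hG h081R hP hqe hdimS
      (affineBlowup.idealSheaf (stalkIdeal J₀ ζ)) (affineBlowup.idealSheaf_ne_bot hI₀)
  -- `𝔟 = 𝔮~`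
  let eΓ := Scheme.ΓSpecIso (.of (X₁.presheaf.stalk ζ))
  let 𝔮 : Ideal (X₁.presheaf.stalk ζ) := (𝔟.ideal ⟨⊤, isAffineOpen_top _⟩).map eΓ.hom.hom
  have hcomp : eΓ.inv.hom.comp eΓ.hom.hom = RingHom.id _ := by
    rw [← CommRingCat.hom_comp, Iso.hom_inv_id, CommRingCat.hom_id]
  have h𝔮map : 𝔮.map eΓ.inv.hom = 𝔟.ideal ⟨⊤, isAffineOpen_top _⟩ := by
    rw [Ideal.map_map, hcomp, Ideal.map_id]
  have h𝔟eq : affineBlowup.idealSheaf 𝔮 = 𝔟 := by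
    apply Scheme.IdealSheafData.ext_of_isAffine
    rw [affineBlowup.idealSheaf, ideal_ofIdealTop_top, h𝔮map]
  have h𝔮0 : 𝔮 ≠ ⊥ := by
    intro h0
    apply h𝔟
    rw [← h𝔟eq, h0]
    apply Scheme.IdealSheafData.ext_of_isAffine
    rw [affineBlowup.idealSheaf, ideal_ofIdealTop_top, Ideal.map_bot, Scheme.IdealSheafData.ideal_bot, Pi.bot_apply]
  have hprod : affineBlowup.idealSheaf (stalkIdeal J₀ ζ) * 𝔟 = affineBlowup.idealSheaf (stalkIdeal J₀ ζ * 𝔮) := by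
    rw [affineBlowup.idealSheaf_mul, h𝔟eq]
  -- generators
  obtain ⟨m, c, hc⟩ := Submodule.fg_iff_exists_fin_generating_family.mp (IsNoetherian.noetherian 𝔮)
  obtain ⟨n, d, hd⟩ := Submodule.fg_iff_exists_fin_generating_family.mp (IsNoetherian.noetherian (stalkIdeal J₀ ζ * 𝔮))
  have hc' : Ideal.span (Set.range c) = 𝔮 := hc
  have hd' : Ideal.span (Set.range d) = stalkIdeal J₀ ζ * 𝔮 := hd
  have hreg : Scheme.IsRegular (affineBlowup (Ideal.span (Set.range d))) := by
    refine hall _ (affineBlowup.π (Ideal.span (Set.range d))) ?_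
    rw [hprod, ← hd']
    exact affineBlowup.isBlowup _
  refine ⟨m, c, n, d, by rw [hc']; exact h𝔮0, by rw [hd', hc'], fun j 𝔔 => ?_, fun P hP𝔮 => ?_⟩
  · -- charts: as in `DominatingLocFixLocal` (prime ↦ point of the chart of the regular affine blowing up)
    have hdj : ∀ j, d j ∈ Ideal.span (Set.range d) := fun j => Ideal.mem_span_range_self (f := d) (x := j)
    set ε : chartRing d j ≃+* blowupAlgebra (Ideal.span (Set.range d)) (d j) :=
      reesChartEquiv (I := Ideal.span (Set.range d)) (d j) (hdj j) with hεdef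
    let w : Spec (.of (chartRing d j)) :=
      ⟨𝔔.asIdeal.comap (ε : chartRing d j →+* _), Ideal.comap_isPrime (ε : chartRing d j →+* _) 𝔔.asIdeal⟩
    have hmemw : ∀ b : chartRing d j, ε b ∈ 𝔔.asIdeal ↔ b ∈ w.asIdeal := fun b => Iff.rfl
    haveI : IsIso ((affineBlowup.chartι (I := Ideal.span (Set.range d)) (d j) (hdj j)).stalkMap w) := inferInstance
    haveI := w.2
    haveI := 𝔔.2
    obtain ⟨e3⟩ := BlowupFiModelOfCover.nonempty_ringEquiv_localization_of_ringEquiv ε w.asIdeal 𝔔.asIdeal hmemw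
    have e : (affineBlowup (Ideal.span (Set.range d))).presheaf.stalk
        ((affineBlowup.chartι (I := Ideal.span (Set.range d)) (d j) (hdj j)) w) ≃+* Localization.AtPrime 𝔔.asIdeal :=
      ((asIso ((affineBlowup.chartι (I := Ideal.span (Set.range d)) (d j) (hdj j)).stalkMap w)).commRingCatIsoToRingEquiv.trans
        (Spec.stalkIso (.of (chartRing d j)) w).commRingCatIsoToRingEquiv).trans e3
    have hregx : IsRegularLocalRing ((affineBlowup (Ideal.span (Set.range d))).presheaf.stalk
        ((affineBlowup.chartι (I := Ideal.span (Set.range d)) (d j) (hdj j)) w)) := hreg _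
    have hreg𝔔 : IsRegularLocalRing (Localization.AtPrime 𝔔.asIdeal) := by
      haveI := hregx
      exact IsRegularLocalRing.of_ringEquiv e
    haveI : CharP (Localization.AtPrime 𝔔.asIdeal) p :=
      CharP.of_ringHom_of_ne_zero
        ((algebraMap (blowupAlgebra (Ideal.span (Set.range d)) (d j)) (Localization.AtPrime 𝔔.asIdeal)).comp
          ((algebraMap (X₁.presheaf.stalk ζ) (blowupAlgebra (Ideal.span (Set.range d)) (d j))).comp
            ((X₁.presheaf.germ ⊤ ζ trivial).hom.comp (f₁.appTop.hom.comp (Scheme.ΓSpecIso (.of k)).inv.hom))))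
        p hp.out.ne_zero
    haveI := hreg𝔔
    exact ⟨hreg𝔔, FiClauseOfRegular.stub_fiClauseOfRegular p _⟩
  · -- support: `P ⊇ 𝔮` is a point of `supp 𝔮~ = supp 𝔟 ⊆ Sing S ∪ NonPrinc (J₀,ζ)~`
    let s : Spec (.of (X₁.presheaf.stalk ζ)) := P
    have hs : s ∈ (𝔟.support : Set (Spec (.of (X₁.presheaf.stalk ζ)))) := by
      rw [← h𝔟eq, affineBlowup.idealSheaf, Scheme.IdealSheafData.coe_support_ofIdealTop, Spec_zeroLocus, ← Ideal.coe_comap,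
        Ideal.comap_map_of_bijective _ (ConcreteCategory.bijective_of_isIso (C := CommRingCat) eΓ.inv)]
      change ((𝔮 : Ideal (X₁.presheaf.stalk ζ)) : Set (X₁.presheaf.stalk ζ)) ⊆ (P.asIdeal : Set (X₁.presheaf.stalk ζ))
      intro x hx
      apply hP𝔮
      rw [hc']
      exact hx
    rcases hsupp hs with h | h
    · refine Or.inl fun hreg' => h ?_
      rw [Scheme.mem_regularLocus]
      haveI := hreg'
      exact IsRegularLocalRing.of_ringEquiv (Spec.stalkIso (.of (X₁.presheaf.stalk ζ)) s).commRingCatIsoToRingEquiv.symm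
    · refine Or.inr fun hpr => h ?_
      -- `stalkIdeal (J₀,ζ)~ s` is the pull-back of the principal `J₀,ζ (𝒪_ζ)_P` along `𝒪_{S,s} ≅ (𝒪_ζ)_P`
      have hback : stalkIdeal (affineBlowup.idealSheaf (stalkIdeal J₀ ζ)) s =
          ((stalkIdeal (affineBlowup.idealSheaf (stalkIdeal J₀ ζ)) s).map
            (Spec.stalkIso (CommRingCat.of (X₁.presheaf.stalk ζ)) s).hom.hom).map
              (Spec.stalkIso (CommRingCat.of (X₁.presheaf.stalk ζ)) s).inv.hom := by
        rw [Ideal.map_map, ← CommRingCat.hom_comp, Iso.hom_inv_id, CommRingCat.hom_id, Ideal.map_id]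
      have h5 := map_stalkIso_stalkIdeal_idealSheaf (stalkIdeal J₀ ζ) s
      rw [hback, h5]
      exact isPrincipal_map _ hpr

end Summit.ResolutionOfSingularities.ResolutionOfSingularities.Theorems.FInjectiveMacaulayfication.DominatingLocFixLocalSupported

end
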